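import Mathlib.Analysis.Calculus.IteratedDeriv.Lemmas
import Mathlib.Analysis.Complex.CauchyIntegral
import Mathlib.MeasureTheory.Integral.Bochner.ContinuousLinearMap
import Literature.NumberTheory.LFunctions.DeBruijnHZeroProofs
import HarnessLib

/-!
# The Taylor coefficients of `ξ` at `1/2` are moments of the Pólya–de Bruijn kernel — proved

Trunk T-ANT (`Literature/NumberTheory/LFunctions`). Discharges the named fact
`Literature.NumberTheory.LFunctions.xiTaylorCoeff_pos` of `RiemannXi.lean` (`γ(n) > 0` for the Griffin–Ono–Rolen–Zagier
coefficients `γ(n)` of `(-1 + 4z²) Λ(1/2 + z) = ∑ γ(n) z^{2n}/n!`, GORZ, PNAS 116 (2019), §1), and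
provides the integral formula for `ξ⁽²ⁿ⁾(1/2)` on which the asymptotic analysis of the `γ(n)`
(GORZ Thm. 7, §5.1; needed for `Literature.NumberTheory.LFunctions.gorz_eventually`) rests.

Source of the argument: Riemann's integral representation `Ξ(t) = 2∫₀^∞ Φ(u) cos(ut) du`
(Titchmarsh, *The Theory of the Riemann Zeta-Function*, 2nd ed. 1986, §10.1, (10.1.2)–(10.1.4)),
in the Rodgers–Tao normalisation already PROVED in the tree as
`Literature.deBruijnH_zero_eq_holds : H_0(z) = ξ(1/2 + iz/2)/8` (`DeBruijnHZeroProofs.lean`) with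
`H_0(z) = ∫₀^∞ Φ(u) cos(zu) du`, `Φ = Literature.deBruijnPhi > 0` (`deBruijnPhi_pos_holds`).
Expanding `cos` (equivalently: differentiating under the integral sign) gives
`ξ⁽²ⁿ⁾(1/2) = 8 · 4ⁿ ∫₀^∞ Φ(u) u²ⁿ du > 0` — the classical proof that the Taylor coefficients of
`ξ` at `1/2` are positive (Titchmarsh §10.1; Pólya 1927; Csordas–Norfolk–Varga 1986, (1.5)).

## Contents (all proved)

* `Literature.xiMoment k = ∫₀^∞ Φ(u) uᵏ du`, integrable (`integrableOn_deBruijnPhi_mul_pow`) and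
  positive (`xiMoment_pos`).
* `Literature.deBruijnH0Deriv k z = ∫₀^∞ Φ(u) uᵏ cos(zu + kπ/2) du` and
  `Literature.iteratedDeriv_deBruijnH_zero : iteratedDeriv k (deBruijnH 0) = deBruijnH0Deriv k`
  (differentiation under the integral sign, dominated by `k! · |Φ(u)| e^{(|Im z|+2)u}`, reusing
  `Literature.NumberTheory.LFunctions.deBruijnHBound` / `integrableOn_deBruijnHBound` of `DeBruijnNewmanProofs.lean`).
* `Literature.iteratedDeriv_riemannXi_half : ξ⁽ᵏ⁾(1/2) = 8 (-2i)ᵏ H_0⁽ᵏ⁾(0)` and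
  `Literature.iteratedDeriv_two_mul_riemannXi_half : ξ⁽²ⁿ⁾(1/2) = 8 · 4ⁿ · M_{2n}`.
* `Literature.xiTaylorCoeff_eq_xiMoment : γ(n) = 64 · 4ⁿ · n!/(2n)! · M_{2n}` and the **discharge**
  `Literature.xiTaylorCoeff_pos_holds : xiTaylorCoeff_pos`.

## References

* E. C. Titchmarsh, *The Theory of the Riemann Zeta-Function*, 2nd ed. (1986), §10.1.
* M. Griffin, K. Ono, L. Rolen, D. Zagier, *Jensen polynomials for the Riemann zeta function and
  other sequences*, PNAS 116 (2019) 11103–11110, §1 and eq. (1). [GORZPNAS2019]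
* G. Csordas, T. S. Norfolk, R. S. Varga, *The Riemann hypothesis and the Turán inequalities*,
  Trans. AMS 296 (1986), 521–541, Thm. A and (1.5) (`b_m = ∫ t^{2m} Φ(t) dt > 0`).
* B. Rodgers, T. Tao, *The de Bruijn–Newman constant is non-negative*, Forum Math. Pi 8 (2020),
  eqs. (1)–(3) (normalisation of `Φ` and `H_0`).
-/

noncomputable section

open Complex MeasureTheory Set Filter Topology
open scoped Nat Real

namespace Literature.NumberTheory.LFunctions

/-! ## The moments `M_k = ∫₀^∞ Φ(u) u^k du` -/

/-- The `k`-th moment `M_k = ∫₀^∞ Φ(u) uᵏ du` of the Pólya–de Bruijn kernel `Φ = Literature.deBruijnPhi`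
(Rodgers–Tao normalisation, `H_0(z) = ∫₀^∞ Φ(u) cos(zu) du = ξ(1/2 + iz/2)/8`). [folklore] -/
def xiMoment (k : ℕ) : ℝ :=
  ∫ u in Ioi (0 : ℝ), deBruijnPhi u * u ^ k

/-- `uᵏ ≤ k! · eᵘ` for `u ≥ 0`. [folklore] -/
theorem pow_le_factorial_mul_exp {u : ℝ} (hu : 0 ≤ u) (k : ℕ) :
    u ^ k ≤ (k ! : ℝ) * Real.exp u := by
  have h := Real.pow_div_factorial_le_exp u hu k
  have hk : (0 : ℝ) < k ! := by exact_mod_cast Nat.factorial_pos k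
  rw [div_le_iff₀ hk] at h
  linarith [mul_comm (Real.exp u) (k ! : ℝ)]

/-- Domination `|Φ(u) uᵏ| ≤ k! · (|Φ(u)| eᵘ) = k! · deBruijnHBound 0 1 u` for `u ≥ 0`. [folklore] -/
theorem abs_deBruijnPhi_mul_pow_le {u : ℝ} (hu : 0 ≤ u) (k : ℕ) :
    |deBruijnPhi u * u ^ k| ≤ (k ! : ℝ) * deBruijnHBound 0 1 u := by
  rw [deBruijnHBound, abs_mul, abs_of_nonneg (pow_nonneg hu k), zero_mul, Real.exp_zero, one_mul,
    one_mul]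
  calc |deBruijnPhi u| * u ^ k ≤ |deBruijnPhi u| * ((k ! : ℝ) * Real.exp u) := by
        gcongr; exact pow_le_factorial_mul_exp hu k
    _ = (k ! : ℝ) * (|deBruijnPhi u| * Real.exp u) := by ring

/-- `u ↦ Φ(u) uᵏ` is continuous. [folklore] -/
theorem continuous_deBruijnPhi_mul_pow (k : ℕ) : Continuous fun u : ℝ ↦ deBruijnPhi u * u ^ k :=
  continuous_deBruijnPhi.mul (continuous_id.pow k)

/-- `u ↦ Φ(u) uᵏ` is integrable on `(0, ∞)` (super-exponential decay of `Φ`). [folklore] -/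
theorem integrableOn_deBruijnPhi_mul_pow (k : ℕ) :
    IntegrableOn (fun u : ℝ ↦ deBruijnPhi u * u ^ k) (Ioi 0) :=
  ((integrableOn_deBruijnHBound 0 1).const_mul (k ! : ℝ)).mono'
    ((continuous_deBruijnPhi_mul_pow k).aestronglyMeasurable.restrict)
    (ae_restrict_of_forall_mem measurableSet_Ioi fun _ hu ↦ by
      rw [Real.norm_eq_abs]; exact abs_deBruijnPhi_mul_pow_le (le_of_lt hu) k)

/-- **Positivity of the moments**: `M_k > 0`, since `Φ > 0` on `[0, ∞)` (`deBruijnPhi_pos`).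
[folklore] -/
theorem xiMoment_pos (k : ℕ) : 0 < xiMoment k := by
  rw [xiMoment, setIntegral_pos_iff_support_of_nonneg_ae
    (ae_restrict_of_forall_mem measurableSet_Ioi fun u hu ↦
      (mul_pos (deBruijnPhi_pos_of_nonneg (le_of_lt hu)) (pow_pos hu k)).le)
    (integrableOn_deBruijnPhi_mul_pow k)]
  have hsub : Ioi (0 : ℝ) ⊆ (Function.support fun u : ℝ ↦ deBruijnPhi u * u ^ k) ∩ Ioi 0 :=
    fun u hu ↦ ⟨(mul_pos (deBruijnPhi_pos_of_nonneg (le_of_lt hu)) (pow_pos hu k)).ne', hu⟩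
  exact lt_of_lt_of_le (by simp) (measure_mono hsub)

/-! ## The derivatives of `H_0` under the integral sign -/

/-- The integrand `Φ(u) uᵏ cos(zu + kπ/2)` of the `k`-th derivative of
`H_0(z) = ∫₀^∞ Φ(u) cos(zu) du` (`d^k/dz^k cos(zu) = uᵏ cos(zu + kπ/2)`). [folklore] -/
def deBruijnH0DerivIntegrand (k : ℕ) (z : ℂ) (u : ℝ) : ℂ :=
  ((deBruijnPhi u * u ^ k : ℝ) : ℂ) * Complex.cos (z * u + ((k * (π / 2) : ℝ) : ℂ))

/-- `H_0^{(k)}(z) := ∫₀^∞ Φ(u) uᵏ cos(zu + kπ/2) du` (shown below to be the `k`-th derivative of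
`H_0`). [folklore] -/
def deBruijnH0Deriv (k : ℕ) (z : ℂ) : ℂ :=
  ∫ u in Ioi (0 : ℝ), deBruijnH0DerivIntegrand k z u

/-- At `k = 0` the integrand is that of `H_0`. [folklore] -/
theorem deBruijnH0DerivIntegrand_zero (z : ℂ) (u : ℝ) :
    deBruijnH0DerivIntegrand 0 z u = deBruijnHIntegrand 0 z u := by
  simp [deBruijnH0DerivIntegrand, deBruijnHIntegrand]

/-- `H_0^{(0)} = H_0`. [folklore] -/
theorem deBruijnH0Deriv_zero : deBruijnH0Deriv 0 = deBruijnH 0 := by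
  funext z
  rw [deBruijnH0Deriv, deBruijnH_eq_integral]
  exact setIntegral_congr_fun measurableSet_Ioi fun u _ ↦ deBruijnH0DerivIntegrand_zero z u

/-- The integrand is continuous in `u`. [folklore] -/
theorem continuous_deBruijnH0DerivIntegrand (k : ℕ) (z : ℂ) :
    Continuous (deBruijnH0DerivIntegrand k z) :=
  (Complex.continuous_ofReal.comp (continuous_deBruijnPhi_mul_pow k)).mul
    (Complex.continuous_cos.comp
      ((continuous_const.mul Complex.continuous_ofReal).add continuous_const))

/-- The imaginary part of the phase-shifted argument: `Im(zu + kπ/2) = (Im z) u`. [folklore] -/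
theorem im_mul_add_phase (z : ℂ) (u c : ℝ) : (z * u + (c : ℂ)).im = z.im * u := by
  simp

/-- Domination: `‖Φ(u) uᵏ cos(zu + kπ/2)‖ ≤ k! · |Φ(u)| e^{(Y+1)u} = k! · deBruijnHBound 0 (Y+1) u`
for `u ≥ 0` and `|Im z| ≤ Y`. [folklore] -/
theorem norm_deBruijnH0DerivIntegrand_le {Y : ℝ} {z : ℂ} (hz : |z.im| ≤ Y) {u : ℝ} (hu : 0 ≤ u)
    (k : ℕ) : ‖deBruijnH0DerivIntegrand k z u‖ ≤ (k ! : ℝ) * deBruijnHBound 0 (Y + 1) u := by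
  rw [deBruijnH0DerivIntegrand, norm_mul, Complex.norm_real, Real.norm_eq_abs, deBruijnHBound,
    zero_mul, Real.exp_zero, one_mul, abs_mul, abs_of_nonneg (pow_nonneg hu k)]
  have hcos : ‖Complex.cos (z * u + ((k * (π / 2) : ℝ) : ℂ))‖ ≤ Real.exp (Y * u) := by
    refine (norm_cos_le_exp_abs_im _).trans (Real.exp_monotone ?_)
    rw [im_mul_add_phase, abs_mul, abs_of_nonneg hu]
    exact mul_le_mul_of_nonneg_right hz hu
  calc |deBruijnPhi u| * u ^ k * ‖Complex.cos (z * u + ((k * (π / 2) : ℝ) : ℂ))‖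
      ≤ |deBruijnPhi u| * ((k ! : ℝ) * Real.exp u) * Real.exp (Y * u) := by
        gcongr
        exact pow_le_factorial_mul_exp hu k
    _ = (k ! : ℝ) * (|deBruijnPhi u| * Real.exp ((Y + 1) * u)) := by
        rw [show (Y + 1) * u = Y * u + u by ring, Real.exp_add]; ring

/-- The integrand of `H_0^{(k)}` is integrable on `(0, ∞)`. [folklore] -/
theorem integrableOn_deBruijnH0DerivIntegrand (k : ℕ) (z : ℂ) :
    IntegrableOn (deBruijnH0DerivIntegrand k z) (Ioi 0) :=
  (((integrableOn_deBruijnHBound 0 (|z.im| + 1)).const_mul (k ! : ℝ))).mono'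
    (continuous_deBruijnH0DerivIntegrand k z).aestronglyMeasurable.restrict
    (ae_restrict_of_forall_mem measurableSet_Ioi fun _ hu ↦
      norm_deBruijnH0DerivIntegrand_le le_rfl (le_of_lt hu) k)

/-- `d/dz [Φ(u) uᵏ cos(zu + kπ/2)] = Φ(u) u^{k+1} cos(zu + (k+1)π/2)`. [folklore] -/
theorem hasDerivAt_deBruijnH0DerivIntegrand (k : ℕ) (u : ℝ) (z : ℂ) :
    HasDerivAt (fun w : ℂ ↦ deBruijnH0DerivIntegrand k w u)
      (deBruijnH0DerivIntegrand (k + 1) z u) z := by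
  have h : HasDerivAt (fun w : ℂ ↦ deBruijnH0DerivIntegrand k w u)
      (((deBruijnPhi u * u ^ k : ℝ) : ℂ) *
        (-Complex.sin (z * u + ((k * (π / 2) : ℝ) : ℂ)) * u)) z :=
    (((hasDerivAt_mul_const (u : ℂ)).add_const (((k * (π / 2) : ℝ) : ℂ))).ccos).const_mul _
  refine h.congr_deriv ?_
  have hphase : (((((k + 1 : ℕ) : ℝ) * (π / 2) : ℝ) : ℂ)) = ((k * (π / 2) : ℝ) : ℂ) + π / 2 := by
    push_cast; ring
  rw [deBruijnH0DerivIntegrand, hphase, ← add_assoc, Complex.cos_add_pi_div_two]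
  push_cast
  ring

/-- **Differentiation under the integral sign**: `(H_0^{(k)})' = H_0^{(k+1)}`. [folklore] -/
theorem hasDerivAt_deBruijnH0Deriv (k : ℕ) (z₀ : ℂ) :
    HasDerivAt (deBruijnH0Deriv k) (deBruijnH0Deriv (k + 1) z₀) z₀ :=
  (hasDerivAt_integral_of_dominated_loc_of_deriv_le (μ := volume.restrict (Ioi 0))
    (F := fun z u ↦ deBruijnH0DerivIntegrand k z u)
    (F' := fun z u ↦ deBruijnH0DerivIntegrand (k + 1) z u) (x₀ := z₀)
    (bound := fun u ↦ ((k + 1)! : ℝ) * deBruijnHBound 0 (|z₀.im| + 1 + 1) u)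
    (Metric.ball_mem_nhds z₀ one_pos)
    (Eventually.of_forall fun z ↦
      (continuous_deBruijnH0DerivIntegrand k z).aestronglyMeasurable.restrict)
    (integrableOn_deBruijnH0DerivIntegrand k z₀)
    (continuous_deBruijnH0DerivIntegrand (k + 1) z₀).aestronglyMeasurable.restrict
    (ae_restrict_of_forall_mem measurableSet_Ioi fun _ hu _ hz ↦
      norm_deBruijnH0DerivIntegrand_le (abs_im_le_of_mem_ball hz) (le_of_lt hu) (k + 1))
    ((integrableOn_deBruijnHBound _ _).const_mul _)
    (ae_restrict_of_forall_mem measurableSet_Ioi fun u _ z _ ↦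
      hasDerivAt_deBruijnH0DerivIntegrand k u z)).2

/-- `deriv H_0^{(k)} = H_0^{(k+1)}`. [folklore] -/
theorem deriv_deBruijnH0Deriv (k : ℕ) : deriv (deBruijnH0Deriv k) = deBruijnH0Deriv (k + 1) :=
  funext fun z ↦ (hasDerivAt_deBruijnH0Deriv k z).deriv

/-- **The derivatives of `H_0` under the integral sign**:
`H_0^{(k)}(z) = ∫₀^∞ Φ(u) uᵏ cos(zu + kπ/2) du` for all `k` and `z`. [folklore] -/
theorem iteratedDeriv_deBruijnH_zero (k : ℕ) :
    iteratedDeriv k (deBruijnH 0) = deBruijnH0Deriv k := by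
  induction k with
  | zero => rw [iteratedDeriv_zero, deBruijnH0Deriv_zero]
  | succ k ih => rw [iteratedDeriv_succ, ih, deriv_deBruijnH0Deriv]

/-- At `z = 0`: `H_0^{(k)}(0) = cos(kπ/2) M_k`. [folklore] -/
theorem deBruijnH0Deriv_apply_zero (k : ℕ) :
    deBruijnH0Deriv k 0 = ((Real.cos (k * (π / 2)) * xiMoment k : ℝ) : ℂ) := by
  rw [deBruijnH0Deriv, xiMoment, ← integral_const_mul, ← integral_complex_ofReal]
  refine setIntegral_congr_fun measurableSet_Ioi fun u _ ↦ ?_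
  rw [deBruijnH0DerivIntegrand, zero_mul, zero_add, ← Complex.ofReal_cos]
  push_cast
  ring

/-- Even order: `H_0^{(2n)}(0) = (-1)ⁿ M_{2n}`. [folklore] -/
theorem deBruijnH0Deriv_two_mul_apply_zero (n : ℕ) :
    deBruijnH0Deriv (2 * n) 0 = (((-1) ^ n * xiMoment (2 * n) : ℝ) : ℂ) := by
  rw [deBruijnH0Deriv_apply_zero]
  have : Real.cos ((2 * n : ℕ) * (π / 2)) = (-1) ^ n := by
    rw [← Real.cos_nat_mul_pi n]; congr 1; push_cast; ring
  rw [this]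

/-- Odd order: `H_0^{(2n+1)}(0) = 0`. [folklore] -/
theorem deBruijnH0Deriv_two_mul_add_one_apply_zero (n : ℕ) : deBruijnH0Deriv (2 * n + 1) 0 = 0 := by
  rw [deBruijnH0Deriv_apply_zero]
  have : Real.cos ((2 * n + 1 : ℕ) * (π / 2)) = 0 := by
    rw [show ((2 * n + 1 : ℕ) : ℝ) * (π / 2) = n * π + π / 2 by push_cast; ring,
      Real.cos_add_pi_div_two, Real.sin_nat_mul_pi, neg_zero]
  rw [this]
  simp

/-! ## The Taylor coefficients of `ξ` at `1/2` as moments -/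

/-- `ξ(1/2 + w) = 8 H_0(-2iw)` (from `H_0(z) = ξ(1/2 + iz/2)/8`, `deBruijnH_zero_eq_holds`).
[cite: Titchmarsh1986, §10.1] -/
theorem riemannXi_half_add_eq_deBruijnH (w : ℂ) :
    riemannXi (1 / 2 + w) = 8 * deBruijnH 0 (-2 * I * w) := by
  rw [deBruijnH_zero_eq_holds (-2 * I * w)]
  have : (1 / 2 + I * (-2 * I * w) / 2 : ℂ) = 1 / 2 + w := by
    ring_nf; rw [Complex.I_sq]; ring
  rw [this]; ring

/-- **Riemann's moment formula for the derivatives of `ξ` at `1/2`**: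
`ξ⁽ᵏ⁾(1/2) = 8 (-2i)ᵏ cos(kπ/2) M_k`, i.e. `ξ⁽²ⁿ⁾(1/2) = 8 · 4ⁿ · ∫₀^∞ Φ(u) u²ⁿ du` and
`ξ⁽²ⁿ⁺¹⁾(1/2) = 0` (Titchmarsh §10.1: `Ξ(t) = 2∫₀^∞ Φ(u) cos(ut) du` in Titchmarsh's normalisation).
[cite: Titchmarsh1986, §10.1] -/
theorem iteratedDeriv_riemannXi_half (k : ℕ) :
    iteratedDeriv k riemannXi (1 / 2) = 8 * (-2 * I) ^ k * deBruijnH0Deriv k 0 := by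
  have hshift := congrFun (iteratedDeriv_comp_const_add k riemannXi (1 / 2)) 0
  rw [add_zero] at hshift
  rw [← hshift]
  have hfun : (fun z : ℂ ↦ riemannXi (1 / 2 + z)) = fun z ↦ 8 * deBruijnH 0 (-2 * I * z) :=
    funext riemannXi_half_add_eq_deBruijnH
  rw [hfun, iteratedDeriv_const_mul_field]
  have hcd : ContDiff ℂ k (deBruijnH 0) := (differentiable_deBruijnH_holds 0).contDiff
  rw [iteratedDeriv_comp_const_mul hcd (-2 * I)]
  simp only [mul_zero, iteratedDeriv_deBruijnH_zero, mul_assoc]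

/-- **The even derivatives of `ξ` at `1/2` are positive moments**:
`ξ⁽²ⁿ⁾(1/2) = 8 · 4ⁿ · M_{2n}` with `M_{2n} = ∫₀^∞ Φ(u) u²ⁿ du`. [cite: Titchmarsh1986, §10.1] -/
theorem iteratedDeriv_two_mul_riemannXi_half (n : ℕ) :
    iteratedDeriv (2 * n) riemannXi (1 / 2) = ((8 * 4 ^ n * xiMoment (2 * n) : ℝ) : ℂ) := by
  rw [iteratedDeriv_riemannXi_half, deBruijnH0Deriv_two_mul_apply_zero, pow_mul]
  have hI : (-2 * I) ^ 2 = -4 := by ring_nf; rw [Complex.I_sq]; ring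
  rw [hI]
  push_cast
  have h4 : (-4 : ℂ) ^ n * (-1) ^ n = 4 ^ n := by rw [← mul_pow]; norm_num
  linear_combination 8 * (xiMoment (2 * n) : ℂ) * h4

/-- **The GORZ coefficients as moments**:
`γ(n) = 8 · n!/(2n)! · ξ⁽²ⁿ⁾(1/2) = 64 · 4ⁿ · n!/(2n)! · M_{2n}` (GORZ, PNAS 116 (2019), eq. (1)
with Titchmarsh §10.1). [cite: GORZPNAS2019, eq. (1)] -/
theorem xiTaylorCoeff_eq_xiMoment (n : ℕ) :
    xiTaylorCoeff n = 64 * 4 ^ n * (n ! : ℝ) / ((2 * n)! : ℝ) * xiMoment (2 * n) := by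
  rw [xiTaylorCoeff, iteratedDeriv_two_mul_riemannXi_half]
  have : (8 * (n ! : ℂ) / ((2 * n)! : ℂ) * ((8 * 4 ^ n * xiMoment (2 * n) : ℝ) : ℂ)) =
      ((64 * 4 ^ n * (n ! : ℝ) / ((2 * n)! : ℝ) * xiMoment (2 * n) : ℝ) : ℂ) := by
    push_cast; ring
  rw [this, Complex.ofReal_re]

/-- **Discharge** of `Literature.NumberTheory.LFunctions.xiTaylorCoeff_pos` (`RiemannXi.lean`): the GORZ Taylor coefficients
`γ(n)` of `(-1 + 4z²) Λ(1/2 + z)` are positive for all `n` (GORZ, PNAS 116 (2019), §1; classical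
from Riemann's integral representation, Titchmarsh §10.1), by
`γ(n) = 64 · 4ⁿ · n!/(2n)! · ∫₀^∞ Φ(u) u²ⁿ du` and `Φ > 0`. [cite: GORZPNAS2019, §1] -/
theorem xiTaylorCoeff_pos_holds : xiTaylorCoeff_pos := by
  intro n
  rw [xiTaylorCoeff_eq_xiMoment]
  have h1 : (0 : ℝ) < n ! := by exact_mod_cast Nat.factorial_pos n
  have h2 : (0 : ℝ) < (2 * n)! := by exact_mod_cast Nat.factorial_pos (2 * n)
  have h3 := xiMoment_pos (2 * n)
  positivity

/-- All even derivatives `ξ⁽²ⁿ⁾(1/2)` are positive reals. [cite: Titchmarsh1986, §10.1] -/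
theorem iteratedDeriv_two_mul_riemannXi_half_pos (n : ℕ) :
    0 < (iteratedDeriv (2 * n) riemannXi (1 / 2)).re ∧
      (iteratedDeriv (2 * n) riemannXi (1 / 2)).im = 0 := by
  rw [iteratedDeriv_two_mul_riemannXi_half, Complex.ofReal_re, Complex.ofReal_im]
  exact ⟨by have := xiMoment_pos (2 * n); positivity, rfl⟩

end Literature.NumberTheory.LFunctions

end
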